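import Summits.CriticalPhenomena.CardyFormulaZ2.Theses.UnionJackBeffara
import Literature.Probability.Percolation.SmirnovTheoremProofs

/-!
# Route UnionJackBeffara — the endgame `UnionJackMorera → UnionJackCardy`

Closes the support item `UnionJackEndgame` (stmt-CriticalPhenomena-4561) of route
`UnionJackBeffara` (sub-problem `CardyFormulaZ2`): if, for every conformal rectangle `R` and every
Carleson datum `(a, b, c, d, ψ)`, two Smirnov separating families sandwich the crude `P_{1/2,1/2}`
site-crossing probability of `R` on the centred square lattice `δG_s` up to `e(δ) → 0` at points
`z⁻_δ, z⁺_δ → d'`, then that crossing probability converges to `cardyFunction (crossRatio x)` for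
every uniformizing datum `(φ, x)` of `R`.

The proof is the tree's passage to the limit for the triangular lattice with the crossing
probability abstracted: both bounds tend to Carleson's ratio `|d - c| / |a - c|` by the
Arzelà–Ascoli argument `IsSmirnovFamily.tendsto_apply_one` (fed with the PROVED facts (M)
`triangleIntegral_eq_zero_of_forall_lattice_holds` and (U) `smirnov_claim24_holds`), so the
sandwiched quantity does (squeeze); a Carleson datum exists for every conformal rectangle by the
PROVED fact (B) `exists_isCarlesonMap_holds`, and Carleson's ratio is `F(η(x))` by the PROVED
Cardy–Carleson identity (C) `cardyFunction_crossRatio_eq_carlesonRatio_holds`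
(cf. `smirnov_tendsto_triDomainCrossingProb_of_limitArgument`,
`hasCrossingLimit_triDomainCrossingProb_of_carleson`).

References: B. Bollobás, O. Riordan, *Percolation*, CUP (2006), Ch. 7, Thm. 2 (p. 165), proof
pp. 202–203, Claim 24 p. 201, eq. (3) p. 163; S. Smirnov, C. R. Acad. Sci. Paris 333 (2001),
Thm. 1; V. Beffara, *Is critical 2D percolation universal?* (2008), §3–§4.
-/

noncomputable section

namespace Summit.CriticalPhenomena.CardyFormulaZ2.Theorems

open scoped Topology
open Filter Set
open Literature.Probability.Percolation Literature.Probability.RandomPlanarGeometry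

/-- **A sandwich by Smirnov separating families forces Carleson's ratio** (Bollobás–Riordan 2006,
proof of Thm. 2, pp. 202–203, with the crossing probability abstracted to an arbitrary family
`p : ℝ → ℝ`): if `g⁻`, `g⁺` are Smirnov separating families for `R` and the Carleson datum
`(a, b, c, d, ψ)`, `z⁻_δ, z⁺_δ ∈ Ω` tend to `d' = R.pt 3`, `e(δ) → 0`, and
`g⁻_δ¹(z⁻_δ) - e(δ) ≤ p(δ) ≤ g⁺_δ¹(z⁺_δ) + e(δ)` for `0 < δ < δ₀`, then `p(δ) → |d - c| / |a - c|`
as `δ → 0⁺`. Both bounds converge by `IsSmirnovFamily.tendsto_apply_one` with the proved facts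
(M) and (U). [cite: BollobasRiordan2006, Ch. 7 proof of Thm. 2 pp. 202–203] -/
theorem tendsto_carlesonRatio_of_smirnovFamily_sandwich {R : ConformalRectangle} {a b c d : ℂ}
    {ψ : ConformalEquiv R.carrier (openTriangle a b c)} {δ₀ : ℝ} {gm gp : ℝ → Fin 3 → ℂ → ℝ}
    {zm zp : ℝ → ℂ} {e p : ℝ → ℝ} (hδ₀ : 0 < δ₀) (habc : IsEquilateral a b c)
    (hd : d ∈ openSegment ℝ c a) (hψ : IsCarlesonMap R a b c d ψ)
    (hgm : IsSmirnovFamily R a b c δ₀ gm) (hgp : IsSmirnovFamily R a b c δ₀ gp)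
    (hzmem : ∀ δ ∈ Ioo 0 δ₀, zm δ ∈ R.carrier ∧ zp δ ∈ R.carrier)
    (hzm : Tendsto zm (𝓝[>] 0) (𝓝 (R.pt 3))) (hzp : Tendsto zp (𝓝[>] 0) (𝓝 (R.pt 3)))
    (he : Tendsto e (𝓝[>] 0) (𝓝 0))
    (hsand : ∀ δ ∈ Ioo 0 δ₀, gm δ 1 (zm δ) - e δ ≤ p δ ∧ p δ ≤ gp δ 1 (zp δ) + e δ) :
    Tendsto p (𝓝[>] 0) (𝓝 (carlesonRatio a c d)) := by
  have h1 := hgm.tendsto_apply_one triangleIntegral_eq_zero_of_forall_lattice_holds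
    smirnov_claim24_holds hδ₀ habc hd hψ (fun δ hδ => (hzmem δ hδ).1) hzm
  have h2 := hgp.tendsto_apply_one triangleIntegral_eq_zero_of_forall_lattice_holds
    smirnov_claim24_holds hδ₀ habc hd hψ (fun δ hδ => (hzmem δ hδ).2) hzp
  have hev : ∀ᶠ δ in 𝓝[>] (0 : ℝ), δ ∈ Ioo 0 δ₀ := Ioo_mem_nhdsGT hδ₀
  have hlow : Tendsto (fun δ => gm δ 1 (zm δ) - e δ) (𝓝[>] 0) (𝓝 (carlesonRatio a c d)) := by
    simpa using h1.sub he
  have hup : Tendsto (fun δ => gp δ 1 (zp δ) + e δ) (𝓝[>] 0) (𝓝 (carlesonRatio a c d)) := by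
    simpa using h2.add he
  exact tendsto_of_tendsto_of_tendsto_of_le_of_le' hlow hup (hev.mono fun δ hδ => (hsand δ hδ).1)
    (hev.mono fun δ hδ => (hsand δ hδ).2)

/-- **Smirnov's endgame with the crossing probability abstracted**: if a family of crossing
probabilities `p R : ℝ → ℝ` of conformal rectangles is, for every `R` and every Carleson datum,
sandwiched by two Smirnov separating families as in (D) `smirnov_exists_separatingFamilies`, then
`R.HasCrossingLimit (p R) cardyFunction` for every `R`: a Carleson datum exists
(`exists_isCarlesonMap_holds`), `F(η(x))` is Carleson's ratio
(`cardyFunction_crossRatio_eq_carlesonRatio_holds`), and the sandwich forces that ratio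
(`tendsto_carlesonRatio_of_smirnovFamily_sandwich`). Bollobás–Riordan 2006, proof of Thm. 2,
pp. 202–203 and eq. (3) p. 163. [cite: BollobasRiordan2006, Ch. 7 Thm. 2, proof pp. 202–203] -/
theorem hasCrossingLimit_of_smirnovFamily_sandwich (p : ConformalRectangle → ℝ → ℝ)
    (hD : ∀ (R : ConformalRectangle) (a b c d : ℂ) (ψ : ConformalEquiv R.carrier (openTriangle a b c)),
      IsEquilateral a b c → d ∈ openSegment ℝ c a → IsCarlesonMap R a b c d ψ →
        ∃ δ₀ > (0 : ℝ), ∃ gm gp : ℝ → Fin 3 → ℂ → ℝ,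
          IsSmirnovFamily R a b c δ₀ gm ∧ IsSmirnovFamily R a b c δ₀ gp ∧
            ∃ (zm zp : ℝ → ℂ) (e : ℝ → ℝ), (∀ δ ∈ Ioo 0 δ₀, zm δ ∈ R.carrier ∧ zp δ ∈ R.carrier) ∧
              Tendsto zm (𝓝[>] 0) (𝓝 (R.pt 3)) ∧ Tendsto zp (𝓝[>] 0) (𝓝 (R.pt 3)) ∧
                Tendsto e (𝓝[>] 0) (𝓝 0) ∧
                  ∀ δ ∈ Ioo 0 δ₀, gm δ 1 (zm δ) - e δ ≤ p R δ ∧ p R δ ≤ gp δ 1 (zp δ) + e δ)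
    (R : ConformalRectangle) :
    R.HasCrossingLimit (p R) Literature.Probability.RandomPlanarGeometry.cardyFunction := by
  intro φ x hφ
  obtain ⟨a, b, c, d, ψ, habc, hd, hψ⟩ := exists_isCarlesonMap_holds R
  rw [cardyFunction_crossRatio_eq_carlesonRatio_holds R a b c d ψ φ x habc hd hψ hφ]
  obtain ⟨δ₀, hδ₀, gm, gp, hgm, hgp, zm, zp, e, hzmem, hzm, hzp, he, hsand⟩ :=
    hD R a b c d ψ habc hd hψ
  exact tendsto_carlesonRatio_of_smirnovFamily_sandwich hδ₀ habc hd hψ hgm hgp hzmem hzm hzp he hsand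

/-- **`UnionJackEndgame` (route UnionJackBeffara, item stmt-CriticalPhenomena-4561):
`UnionJackMorera → UnionJackCardy`.** Smirnov separating families sandwiching the crude
`P_{1/2,1/2}` site-crossing probability of a conformal rectangle on the centred square lattice
`δG_s` force it to converge to Carleson's ratio, hence — Carleson maps exist and the
Cardy–Carleson identity holds — to `cardyFunction (crossRatio x)` for every uniformizing datum.
The `G_s` analogue of the tree's `smirnov_tendsto_triDomainCrossingProb_of_limitArgument` +
`hasCrossingLimit_triDomainCrossingProb_of_carleson`, by
`hasCrossingLimit_of_smirnovFamily_sandwich` applied to the crude crossing probability.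
[cite: BollobasRiordan2006, Ch. 7 Thm. 2, proof pp. 202–203] -/
theorem unionJackEndgame_proof :
    Summit.CriticalPhenomena.CardyFormulaZ2.Theses.UnionJackBeffara.UnionJackEndgame := by
  delta Summit.CriticalPhenomena.CardyFormulaZ2.Theses.UnionJackBeffara.UnionJackEndgame
  intro Z G P hD R
  exact hasCrossingLimit_of_smirnovFamily_sandwich (fun R' => P half R') hD R

end Summit.CriticalPhenomena.CardyFormulaZ2.Theorems

end
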